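import Literature.Analysis.FunctionSpaces.TorusPerturbedNSLocalExistence
import Literature.Analysis.FunctionSpaces.TorusClassicalNSRestart
import Literature.Analysis.FunctionSpaces.TorusClassicalNSUniqueness
import Literature.Analysis.FunctionSpaces.TorusInverseLaplacianCalculus
import Literature.Analysis.FluidPDE.EulerTorusContinuation
import HarnessLib

/-!
# Restarting classical Navier–Stokes solutions on the flat torus from a background trajectory:
# the capped life span of the perturbation system, absorption of the force, gluing on closed windows

Function-space support file (all results proved; no definitions, no named facts), sequel of
`TorusPerturbedNSLocalExistence` (short-time smooth solutions of the perturbed Navier–Stokes system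
`∂ₜv + (v·∇)v + (u·∇)v + (v·∇)u = νΔv − ∇q`, `div v = 0`, `∫ v = 0` around a smooth background `u`
on `[a, b] × T^d`, `#d ≤ 3`, with a life span `θ(ν, u, M)` uniform in the start time `t₀` and in data of
fourth Sobolev sums `≤ M`, `Torus.perturbedNS_exists_local`) and of `TorusClassicalNSGluing` /
`TorusClassicalNSRestart` / `TorusClassicalNSUniqueness` (restriction, pressure normalisation, gluing on
OPEN windows, forward uniqueness). It supplies the three bookkeeping steps of the continuation argument
for classical solutions of the FORCED system NS_ν(F) near a background solution `(ū, p̄)` of the same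
forced system (Robinson–Rodrigo–Sadowski 2016, Thm 6.8 with §8.1: restart from a later time, identify on
the overlap, glue; Majda–Bertozzi 2002, §3.2.3):

* `Torus.perturbedNS_exists_local_of_le` — the existence theorem with a CAPPED life span `θ ≤ θ₁` for
  any prescribed `θ₁ > 0` (the statement of `Torus.perturbedNS_exists_local` only speaks about start
  times `t₀` with `t₀ + θ ≤ b`, which is void when `θ > b − a`; the threshold of
  `PerturbedNSFourier.exists_threshold` holds for every shorter interval, so the same Fourier–Picard
  construction runs on `[0, min θ₀ θ₁]`);
* `Torus.IsClassicalNSSolutionOn.add_perturbation` — **the background absorbs the force**: if `(ū, p̄)`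
  solves NS_ν(f) on `[a, b] × T^d` and `(v, q)` solves the perturbation system around `ū` there, then
  `(ū + v, p̄ + q)` solves NS_ν(f) (add the two momentum equations; `(·∇)·` is bilinear,
  Cheskidov–Luo 2022, §3.1 (3.2));
* `Torus.IsClassicalNSSolutionOn.glue_Icc` — **gluing on closed windows**: classical solutions on
  `[a, b]` and `[a', b']`, `a ≤ a' < m < b ≤ b'`, whose velocities and pressures agree on the open
  overlap `(a', b)` glue (switching at `m`) to a classical solution on `[a, b']` (joint smoothness and
  one-sided time derivatives are local in time: `FluidPDE.Torus.isSmoothSpaceTimeOn_glue`,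
  `FluidPDE.Torus.timeDerivWithin_glue_left/right` of `EulerTorusContinuation`);
* `Torus.IsClassicalNSSolutionOn.glue_restart` — the form consumed by continuation arguments: a
  solution on `[a, b]` and one on `[s, c]`, `a ≤ s < b ≤ c`, `ν ≥ 0`, with the same velocity at the
  restart time `s` glue to a solution on `[a, c]` with the old values on `[a, s]` (hence the same datum)
  and every slice a slice of one of the two pieces (velocities agree on `[s, b]` by `velocity_unique`,
  pressures normalised at a base point agree on `(s, b)` by `pressure_sub_eq_of_eventuallyEq`).

## Mathlib / tree search

Tree (reused): `Torus.perturbedNS_exists_local` and its Fourier-side inputs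
(`PerturbedNSFourier.exists_threshold/ballHyp/vel_isSolution`, `ScalarFourier.exists_hasDecay_mFourierCoeff_spaceTime`,
`GalerkinSmooth.hasDecay_of_weighted_sq_le`), `Torus.timeDerivWithin_add` (`TorusInverseLaplacianCalculus`),
`FluidPDE.Torus.convect_add_left/convect_add_right/laplacian_add_apply/gradient_add_apply`,
`Torus.IsDivFree.add` (`NavierStokesConcentrationTools`), `Torus.IsClassicalNSSolutionOn.mono/sub_pressure_apply/
pressure_sub_eq_of_eventuallyEq/velocity_unique`. Searched `glue_Icc|add_perturbation|perturbedNS_exists_local`: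
only the open-window gluing `glue_Ioo/glue_Ioi` and the closed-window gluing of the Euler–Reynolds and
fractional systems (`IsEulerReynoldsOn.glue`, `IsFracNSReynoldsOn.glue`), whose layout is followed.

## References

* J. C. Robinson, J. L. Rodrigo, W. Sadowski, *The Three-Dimensional Navier–Stokes Equations*, CUP 2016,
  Thm 6.8, §8.1. [RobinsonRodrigoSadowskiCUP2016]
* A. J. Majda, A. L. Bertozzi, *Vorticity and Incompressible Flow*, CUP 2002, Thm. 3.4, §3.2.3.
  [MajdaBertozziCUP2002]
* A. Cheskidov, X. Luo, *Sharp nonuniqueness for the Navier–Stokes equations*, Invent. Math. 229 (2022),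
  §3.1 (3.2). [CheskidovLuo2022]
-/

open MeasureTheory Set Filter
open scoped InnerProductSpace ContDiff Topology

noncomputable section

namespace Literature.Analysis.FunctionSpaces

namespace Torus

open Literature.Analysis.FluidPDE.FourierNS (HasDecay)

variable {d : Type*} [Fintype d] [DecidableEq d]

/-! ## The perturbation system: capped life span -/

section Capped

variable {ν a b : ℝ} {u : ℝ → UnitAddTorus d → EuclideanSpace ℝ d}

/-- **Short-time smooth solutions of the perturbed Navier–Stokes system on `T^d`, `#d ≤ 3`, with a
life span uniform in the start time and in `H⁴`-bounded data, capped by a prescribed `θ₁ > 0`.** Same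
statement as `Torus.perturbedNS_exists_local` (Majda–Bertozzi 2002, Thm. 3.4, for the perturbation
system of Cheskidov–Luo 2022, §3.1 (3.2)) with the extra conclusion `θ ≤ θ₁`, so that restarts from
every `t₀ ∈ [a, b − θ₁]` are available. Proof: verbatim the Fourier–Picard construction of
`Torus.perturbedNS_exists_local`; the threshold `θ₀` of `PerturbedNSFourier.exists_threshold` is valid
for every `0 < θ ≤ θ₀`, and we run the construction with `θ = min θ₀ θ₁`.
[cite: MajdaBertozziCUP2002, Thm. 3.4] -/
theorem perturbedNS_exists_local_of_le (hd : Fintype.card d ≤ 3) (hν : 0 < ν) (hab : a < b)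
    (hu : IsSmoothSpaceTimeOn (Icc a b) u) (hudiv : ∀ t ∈ Icc a b, IsDivFree (u t)) (M : ℝ)
    {θ₁ : ℝ} (hθ₁ : 0 < θ₁) :
    ∃ θ : ℝ, 0 < θ ∧ θ ≤ θ₁ ∧ ∀ t₀ ∈ Icc a b, t₀ + θ ≤ b →
      ∀ (v₀ : UnitAddTorus d → EuclideanSpace ℝ d), IsSmooth v₀ → IsDivFree v₀ → HasZeroMean v₀ →
      (∀ S : Finset (d → ℤ),
        ∑ k ∈ S, (1 + freqNormSq k) ^ 4 * ‖UnitAddTorus.mFourierCoeff (EuclideanSpace.complexify ∘ v₀) k‖ ^ 2 ≤ M) →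
      ∃ (v : ℝ → UnitAddTorus d → EuclideanSpace ℝ d) (q : ℝ → UnitAddTorus d → ℝ),
        IsSmoothSpaceTimeOn (Icc t₀ (t₀ + θ)) v ∧ IsSmoothSpaceTimeOn (Icc t₀ (t₀ + θ)) q ∧
        (∀ t ∈ Icc t₀ (t₀ + θ), IsDivFree (v t)) ∧ (∀ t ∈ Icc t₀ (t₀ + θ), HasZeroMean (v t)) ∧
        (∀ t ∈ Icc t₀ (t₀ + θ), HasZeroMean (q t)) ∧
        (∀ t ∈ Icc t₀ (t₀ + θ), ∀ x, timeDerivWithin (Icc t₀ (t₀ + θ)) v t x + convect (v t) (v t) x +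
          convect (u t) (v t) x + convect (v t) (u t) x = ν • laplacian (v t) x - gradient (q t) x) ∧
        v t₀ = v₀ := by
  -- adapted from `Torus.perturbedNS_exists_local` (same construction, capped interval)
  -- the translated background on `[0, T]`, `T = b - a`, and its global order-four coefficient bound
  set T : ℝ := b - a with hT
  have hT0 : 0 < T := sub_pos.2 hab
  set uT : ℝ → UnitAddTorus d → EuclideanSpace ℝ d := fun s => u (s + a) with huT
  have hpreT : (· + a) ⁻¹' Icc a b = Icc 0 T := by
    rw [FluidPDE.Torus.preimage_add_const_Icc', sub_self]
  have huTs : IsSmoothSpaceTimeOn (Icc 0 T) uT := by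
    have h1 := hu.comp_add_const a
    rwa [hpreT] at h1
  have hAj : ∀ j : d, ∃ C : ℝ, 0 ≤ C ∧ ∀ s ∈ Icc 0 T,
      HasDecay 4 C (fun k => UnitAddTorus.mFourierCoeff (FluidPDE.CorrectorFourier.compC uT j s) k) := fun j =>
    FluidPDE.ScalarFourier.exists_hasDecay_mFourierCoeff_spaceTime hT0 (FluidPDE.CorrectorFourier.isSmoothSpaceTimeOn_compC huTs j) 4
  choose Aj hAj0 hAj using hAj
  set A : ℝ := ∑ j, Aj j with hAdef
  have hA0 : 0 ≤ A := Finset.sum_nonneg fun j _ => hAj0 j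
  have hAall : ∀ s ∈ Icc 0 T, ∀ j,
      HasDecay 4 A (fun k => UnitAddTorus.mFourierCoeff (FluidPDE.CorrectorFourier.compC uT j s) k) := fun s hs j =>
    (hAj j s hs).mono (Finset.single_le_sum (fun i _ => hAj0 i) (Finset.mem_univ j))
  -- the order-four mass, the radius and the (capped) threshold
  set Z : ℝ := ∑' m : d → ℤ, ((1 + ‖m‖) ^ 4)⁻¹ with hZdef
  have hZ : HasSum (fun m : d → ℤ => ((1 + ‖m‖) ^ 4)⁻¹) Z := FluidPDE.PerturbedNSFourier.hasSum_weight_four hd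
  have hZ0 : 0 ≤ Z := FluidPDE.PerturbedNSFourier.weight_four_mass_nonneg hZ
  set M' : ℝ := max M 0 with hM'
  have hM'0 : 0 ≤ M' := le_max_right _ _
  set ρ : ℝ := 2 * (2 ^ 2 * Real.sqrt M') + 1 with hρdef
  have hρ0 : 0 < ρ := by positivity
  obtain ⟨θ₀, hθ₀, hθ₀1, hthr⟩ := FluidPDE.PerturbedNSFourier.exists_threshold (d := d) (ν := ν) hρ0 hZ0 hA0
  set θ : ℝ := min θ₀ θ₁ with hθdef
  have hθ : 0 < θ := lt_min hθ₀ hθ₁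
  have hθ1 : θ ≤ 1 := (min_le_left _ _).trans hθ₀1
  obtain ⟨hS1, hS2⟩ := hthr θ hθ (min_le_left _ _)
  refine ⟨θ, hθ, min_le_right _ _, fun t₀ ht₀ hθb v₀ hv₀ hv₀div hv₀mean hMv => ?_⟩
  -- the translated background on `[0, θ]`
  have hsub : Icc t₀ (t₀ + θ) ⊆ Icc a b := Icc_subset_Icc ht₀.1 hθb
  have hmem : ∀ s ∈ Icc 0 θ, s + t₀ ∈ Icc a b := fun s hs =>
    hsub ⟨by linarith [hs.1], by linarith [hs.2]⟩
  have hpre : (· + t₀) ⁻¹' Icc t₀ (t₀ + θ) = Icc 0 θ := by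
    rw [FluidPDE.Torus.preimage_add_const_Icc', sub_self, add_sub_cancel_left]
  set uτ : ℝ → UnitAddTorus d → EuclideanSpace ℝ d := fun s => u (s + t₀) with huτ
  have huτs : IsSmoothSpaceTimeOn (Icc 0 θ) uτ := by
    have h1 := (hu.mono hsub).comp_add_const t₀
    rwa [hpre] at h1
  have hdivτ : ∀ s ∈ Icc 0 θ, IsDivFree (uτ s) := fun s hs => hudiv (s + t₀) (hmem s hs)
  -- the drift coefficients have order-four constant `A` at all times
  have hUA : ∀ j t, HasDecay 4 A (FluidPDE.CorrectorFourier.driftCoeff θ uτ j t) := by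
    refine FluidPDE.CorrectorFourier.hasDecay_driftCoeff_of_forall hθ.le fun s hs j => ?_
    have hsT : s + (t₀ - a) ∈ Icc 0 T :=
      ⟨by linarith [hs.1, ht₀.1], by linarith [hs.2, hθb]⟩
    have heq : FluidPDE.CorrectorFourier.compC uτ j s = FluidPDE.CorrectorFourier.compC uT j (s + (t₀ - a)) := by
      funext x
      simp only [FluidPDE.CorrectorFourier.compC_apply, huτ, huT]
      congr 4
      ring
    rw [heq]
    exact hAall _ hsT j
  -- the datum lies in the order-four ball of radius `ρ/2`
  have hck : ∀ k, (1 + freqNormSq k) ^ (2 * 2) *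
      ‖UnitAddTorus.mFourierCoeff (EuclideanSpace.complexify ∘ v₀) k‖ ^ 2 ≤ M' := by
    intro k
    have h1 := hMv {k}
    rw [Finset.sum_singleton] at h1
    exact (le_of_eq (by norm_num)).trans (h1.trans (le_max_left _ _))
  have hdec : HasDecay (2 * 2) (2 ^ 2 * Real.sqrt M') (fun k => UnitAddTorus.mFourierCoeff (EuclideanSpace.complexify ∘ v₀) k) :=
    FluidPDE.GalerkinSmooth.hasDecay_of_weighted_sq_le hck
  have ha : ∀ l, HasDecay 4 (ρ / 2) (FluidPDE.LinearisedNSFourier.datumCoeff v₀ l) := by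
    intro l k
    have h1 := hdec k
    have h2 : ‖FluidPDE.LinearisedNSFourier.datumCoeff v₀ l k‖ ≤ ‖UnitAddTorus.mFourierCoeff (EuclideanSpace.complexify ∘ v₀) k‖ := by
      rw [FluidPDE.LinearisedNSFourier.datumCoeff_apply, ← mFourierCoeff_complexify_apply hv₀.integrable k l]
      exact PiLp.norm_apply_le _ l
    refine h2.trans (h1.trans ?_)
    have hw : (0 : ℝ) ≤ ((1 + ‖k‖) ^ 4)⁻¹ := by positivity
    have hρ2 : 2 ^ 2 * Real.sqrt M' ≤ ρ / 2 := by rw [hρdef]; linarith [Real.sqrt_nonneg M']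
    exact mul_le_mul_of_nonneg_right hρ2 hw
  -- the Fourier–Picard solution on the model interval and its translation
  have h := FluidPDE.PerturbedNSFourier.ballHyp hν hθ hθ1 huτs hv₀ hZ hρ0.le hA0 hUA ha hS1 hS2
  obtain ⟨h1, h2, h3, h4, h5, h6, h7⟩ :=
    FluidPDE.PerturbedNSFourier.vel_isSolution h huτs hdivτ hv₀ hv₀div hv₀mean
  set w := FluidPDE.PerturbedNSFourier.vel ν θ uτ v₀ with hw
  set p := FluidPDE.PerturbedNSFourier.pres ν θ uτ v₀ with hp
  have hsubτ : ∀ t ∈ Icc t₀ (t₀ + θ), t - t₀ ∈ Icc 0 θ := fun t ht => ⟨by linarith [ht.1], by linarith [ht.2]⟩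
  refine ⟨fun t => w (t - t₀), fun t => p (t - t₀), h1.comp_sub_const_Icc, h2.comp_sub_const_Icc,
    fun t ht => h3 (t - t₀) (hsubτ t ht), fun t ht => h4 (t - t₀) (hsubτ t ht),
    fun t ht => h5 (t - t₀) (hsubτ t ht), fun t ht x => ?_, ?_⟩
  · have hm := h6 (t - t₀) (hsubτ t ht) x
    simp only [huτ, sub_add_cancel] at hm
    rw [FluidPDE.Torus.timeDerivWithin_comp_sub_const_Icc θ t₀ w t x]
    exact hm
  · change w (t₀ - t₀) = v₀
    rw [sub_self]
    exact h7

end Capped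

/-! ## The background absorbs the force -/

section Absorb

variable {ν a b : ℝ} {f ū v : ℝ → UnitAddTorus d → EuclideanSpace ℝ d} {pbar q : ℝ → UnitAddTorus d → ℝ}

/-- **The background absorbs the force** (Cheskidov–Luo 2022, §3.1 (3.2): the perturbation system is
what remains of NS_ν(f) after subtracting a solution). Let `(ū, p̄)` be a classical solution of the
Navier–Stokes system with viscosity `ν` and force `f` on `[a, b] × T^d`, `a < b`, and let `(v, q)` be
jointly smooth on `[a, b] × T^d` with divergence-free velocity slices and solve the perturbation system
around `ū`, `∂ₜv + (v·∇)v + (ū·∇)v + (v·∇)ū = νΔv − ∇q` (one-sided time derivative within `[a, b]`).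
Then `(ū + v, p̄ + q)` is a classical solution of NS_ν(f) on `[a, b] × T^d`: add the two momentum
equations and expand `((ū + v)·∇)(ū + v)` by bilinearity. [cite: CheskidovLuo2022, §3.1 (3.2)] -/
theorem IsClassicalNSSolutionOn.add_perturbation (hū : IsClassicalNSSolutionOn (Icc a b) ν f ū pbar)
    (hab : a < b) (hv : IsSmoothSpaceTimeOn (Icc a b) v) (hq : IsSmoothSpaceTimeOn (Icc a b) q)
    (hdiv : ∀ t ∈ Icc a b, IsDivFree (v t))
    (heq : ∀ t ∈ Icc a b, ∀ x, timeDerivWithin (Icc a b) v t x + convect (v t) (v t) x +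
      convect (ū t) (v t) x + convect (v t) (ū t) x = ν • laplacian (v t) x - gradient (q t) x) :
    IsClassicalNSSolutionOn (Icc a b) ν f (fun t x => ū t x + v t x) (fun t x => pbar t x + q t x) where
  smooth_velocity := hū.smooth_velocity.add hv
  smooth_pressure := hū.smooth_pressure.add hq
  momentum t ht x := by
    have hU : UniqueDiffOn ℝ (Icc a b) := uniqueDiffOn_Icc hab
    have hūt : IsSmooth (ū t) := hū.smooth_velocity.isSmooth_slice ht
    have hvt : IsSmooth (v t) := hv.isSmooth_slice ht
    have hpt : IsSmooth (pbar t) := hū.smooth_pressure.isSmooth_slice ht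
    have hqt : IsSmooth (q t) := hq.isSmooth_slice ht
    have hū1 : IsContDiff 1 (ū t) := hūt.isContDiff (by simp)
    have hv1 : IsContDiff 1 (v t) := hvt.isContDiff (by simp)
    have h1 := hū.momentum t ht x
    have h2 := heq t ht x
    rw [timeDerivWithin_add hū.smooth_velocity hv hU ht x,
      FluidPDE.Torus.convect_add_left (ū t) (v t) (fun y => ū t y + v t y) x,
      FluidPDE.Torus.convect_add_right (ū t) hū1 hv1 x, FluidPDE.Torus.convect_add_right (v t) hū1 hv1 x,
      FluidPDE.Torus.laplacian_add_apply hūt hvt x,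
      FluidPDE.Torus.gradient_add_apply (hpt.isContDiff (by simp)) (hqt.isContDiff (by simp)) x, smul_add]
    linear_combination (norm := skip) h1 + h2
    abel
  divFree t ht :=
    IsDivFree.add ((hū.smooth_velocity.isSmooth_slice ht).isContDiff (by simp))
      ((hv.isSmooth_slice ht).isContDiff (by simp)) (hū.divFree t ht) (hdiv t ht)

end Absorb

/-! ## Gluing on closed windows -/

section Glue

variable {ν a b a' b' m : ℝ} {f u₁ u₂ : ℝ → UnitAddTorus d → EuclideanSpace ℝ d}
  {p₁ p₂ : ℝ → UnitAddTorus d → ℝ}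

/-- **Gluing classical Navier–Stokes solutions on closed windows.** Let `(u₁, p₁)` solve NS_ν(f) on
`[a, b] × T^d` and `(u₂, p₂)` on `[a', b'] × T^d`, `a ≤ a' < m < b ≤ b'`, and suppose the two solutions
agree (velocity and pressure) on the open overlap `(a', b)`. Then the fields equal to `(u₁, p₁)` for
`t ≤ m` and to `(u₂, p₂)` for `t > m` solve NS_ν(f) on `[a, b'] × T^d`: joint smoothness is local in
time (`FluidPDE.Torus.isSmoothSpaceTimeOn_glue`), and the one-sided time derivatives within `[a, b']` are
those within `[a, b]` at times `< b` and those within `[a', b']` at times `> a'`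
(`FluidPDE.Torus.timeDerivWithin_glue_left/right`); twin of `IsEulerReynoldsOn.glue` /
`IsFracNSReynoldsOn.glue` (Majda–Bertozzi 2002, proof of Thm. 3.5; Robinson–Rodrigo–Sadowski 2016, §8.1).
[folklore] -/
theorem IsClassicalNSSolutionOn.glue_Icc (h₁ : IsClassicalNSSolutionOn (Icc a b) ν f u₁ p₁)
    (h₂ : IsClassicalNSSolutionOn (Icc a' b') ν f u₂ p₂) (haa' : a ≤ a') (ham : a' < m) (hmb : m < b)
    (hbb' : b ≤ b') (heq : ∀ t ∈ Ioo a' b, u₁ t = u₂ t ∧ p₁ t = p₂ t) :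
    IsClassicalNSSolutionOn (Icc a b') ν f (fun t => if t ≤ m then u₁ t else u₂ t)
      (fun t => if t ≤ m then p₁ t else p₂ t) := by
  have ha'b : a' < b := ham.trans hmb
  -- the glued fields agree with the pieces on the two relatively open parts
  have hU₁ : ∀ t ∈ Icc a b', t < b → (if t ≤ m then u₁ t else u₂ t) = u₁ t := by
    intro t _ htb
    by_cases htm : t ≤ m
    · rw [if_pos htm]
    · rw [if_neg htm, (heq t ⟨ham.trans (not_le.1 htm), htb⟩).1]
  have hU₂ : ∀ t ∈ Icc a b', a' < t → (if t ≤ m then u₁ t else u₂ t) = u₂ t := by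
    intro t _ hta
    by_cases htm : t ≤ m
    · rw [if_pos htm, (heq t ⟨hta, htm.trans_lt hmb⟩).1]
    · rw [if_neg htm]
  have hP₁ : ∀ t ∈ Icc a b', t < b → (if t ≤ m then p₁ t else p₂ t) = p₁ t := by
    intro t _ htb
    by_cases htm : t ≤ m
    · rw [if_pos htm]
    · rw [if_neg htm, (heq t ⟨ham.trans (not_le.1 htm), htb⟩).2]
  have hP₂ : ∀ t ∈ Icc a b', a' < t → (if t ≤ m then p₁ t else p₂ t) = p₂ t := by
    intro t _ hta
    by_cases htm : t ≤ m
    · rw [if_pos htm, (heq t ⟨hta, htm.trans_lt hmb⟩).2]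
    · rw [if_neg htm]
  refine ⟨FluidPDE.Torus.isSmoothSpaceTimeOn_glue h₁.smooth_velocity h₂.smooth_velocity ha'b hU₁ hU₂,
    FluidPDE.Torus.isSmoothSpaceTimeOn_glue h₁.smooth_pressure h₂.smooth_pressure ha'b hP₁ hP₂,
    fun t ht x => ?_, fun t ht => ?_⟩
  · by_cases htb : t < b
    · rw [FluidPDE.Torus.timeDerivWithin_glue_left hbb' hU₁ ht htb x]
      simp only [hU₁ t ht htb, hP₁ t ht htb]
      exact h₁.momentum t ⟨ht.1, htb.le⟩ x
    · have hta : a' < t := ha'b.trans_le (not_lt.1 htb)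
      rw [FluidPDE.Torus.timeDerivWithin_glue_right haa' hU₂ ht hta x]
      simp only [hU₂ t ht hta, hP₂ t ht hta]
      exact h₂.momentum t ⟨hta.le, ht.2⟩ x
  · by_cases htm : t ≤ m
    · simp only [if_pos htm]
      exact h₁.divFree t ⟨ht.1, htm.trans hmb.le⟩
    · simp only [if_neg htm]
      exact h₂.divFree t ⟨(ham.trans (not_le.1 htm)).le, ht.2⟩

/-- **Restart and glue.** Let `(u₁, p₁)` solve NS_ν(f), `ν ≥ 0`, on `[a, b] × T^d` and `(u₂, p₂)` on
`[s, c] × T^d`, where `a ≤ s < b ≤ c` and `u₂(s) = u₁(s)` (the second solution is restarted from the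
value of the first at time `s`). Then there is a classical solution `(u, p)` of NS_ν(f) on `[a, c] × T^d`
with `u = u₁` on `[a, s]` and every slice `u(t)` equal to `u₁(t)` (some `t ∈ [a, b]`) or to `u₂(t)` (some
`t ∈ [s, c]`): the velocities agree on `[s, b]` by forward uniqueness
(`velocity_unique`), the pressures normalised at a base point agree on `(s, b)`
(`pressure_sub_eq_of_eventuallyEq`), and `glue_Icc` applies with the switch at the midpoint of `[s, b]`
(Robinson–Rodrigo–Sadowski 2016, §8.1: restart, identify on the overlap, glue). [folklore] -/
theorem IsClassicalNSSolutionOn.glue_restart (hν : 0 ≤ ν) {s c : ℝ}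
    (h₁ : IsClassicalNSSolutionOn (Icc a b) ν f u₁ p₁) (h₂ : IsClassicalNSSolutionOn (Icc s c) ν f u₂ p₂)
    (has : a ≤ s) (hsb : s < b) (hbc : b ≤ c) (h0 : u₂ s = u₁ s) :
    ∃ (u : ℝ → UnitAddTorus d → EuclideanSpace ℝ d) (p : ℝ → UnitAddTorus d → ℝ),
      IsClassicalNSSolutionOn (Icc a c) ν f u p ∧ (∀ t ∈ Icc a s, u t = u₁ t) ∧
        ∀ t ∈ Icc a c, (t ∈ Icc a b ∧ u t = u₁ t) ∨ (t ∈ Icc s c ∧ u t = u₂ t) := by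
  set x₀ : UnitAddTorus d := 0
  -- identification of the velocities on the closed overlap `[s, b]`
  have hsub₁ : Icc s b ⊆ Icc a b := Icc_subset_Icc has le_rfl
  have hsub₂ : Icc s b ⊆ Icc s c := Icc_subset_Icc le_rfl hbc
  have hov : ∀ t ∈ Icc s b, u₁ t = u₂ t := fun t ht =>
    (h₁.mono hsub₁ (uniqueDiffOn_Icc hsb)).velocity_unique hν (h₂.mono hsub₂ (uniqueDiffOn_Icc hsb))
      h0.symm ht
  -- the normalised pressures agree on the open overlap `(s, b)`
  have hpr : ∀ t ∈ Ioo s b, (fun x => p₁ t x - p₁ t x₀) = fun x => p₂ t x - p₂ t x₀ := by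
    intro t ht
    funext x
    exact h₁.pressure_sub_eq_of_eventuallyEq h₂ (Icc_mem_nhds (has.trans_lt ht.1) ht.2)
      (Icc_mem_nhds ht.1 (ht.2.trans_le hbc))
      (by filter_upwards [Ioo_mem_nhds ht.1 ht.2] with τ hτ using hov τ (Ioo_subset_Icc_self hτ)) x x₀
  -- glue at the midpoint
  set m : ℝ := (s + b) / 2 with hm
  have hsm : s < m := by rw [hm]; linarith
  have hmb : m < b := by rw [hm]; linarith
  refine ⟨_, _, (h₁.sub_pressure_apply x₀).glue_Icc (h₂.sub_pressure_apply x₀) has hsm hmb hbc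
    (fun t ht => ⟨hov t (Ioo_subset_Icc_self ht), hpr t ht⟩), fun t ht => ?_, fun t ht => ?_⟩
  · simp only [if_pos (ht.2.trans hsm.le)]
  · by_cases htm : t ≤ m
    · exact Or.inl ⟨⟨ht.1, htm.trans hmb.le⟩, by simp only [if_pos htm]⟩
    · exact Or.inr ⟨⟨(hsm.trans (not_le.1 htm)).le, ht.2⟩, by simp only [if_neg htm]⟩

end Glue

end Torus

end Literature.Analysis.FunctionSpaces

end
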